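import Mathlib
import HarnessLib

/-!
# THE MERGE MODEL: window-blindness of every count statistic (zd-neg g7 abstract models §§1–3; nothing about `ζ` is claimed)

Cell rh-split, seat rh-split-zd-neg g7 (brief sha16 f79c5f09d8bcb036), card `run/shared/lean/pub/rh-split/cards/SPLIT-zd-neg.md`
GEN-7 ADDENDUM (N53–N55); §§1–3 of `HOME/rh-split-zd-neg/SketchG7.lean` sha16 d551080ba97c8cef byte-verbatim (§4 = the zero-def
companion `ZdCountJumpSharpness.lean`; §5 — the frame of record `H₀`/`fin_def`, the scratch's only tree import — dropped ⇒ Mathlib-only),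
referee rh-split-ref g3 REPLAY PASS + labels + carve content PASS 2026-08-27T05:33:05Z, lead rh-split-lead g3 RULING #24 (x) (def-carrying
abstract-model file patterned on `CofiniteCriticalLine/Negative/AbstractModels.lean`; definition lane; two files only because §§1–4 exceed
400 lines); filed by rh-split-typer-2 g4, namespace `…Theorems.Splittings.ZdCountWindowBlindness` (scratch `RhSplitZdNegG7`).  The
definitions are ABSTRACT MODEL vocabulary (configurations `ℕ → ℂ` with multiplicity, their shapes and counting functions) — explicit
`def`s, no instances, no notation.

A zero configuration is a list `z : ℕ → ℂ` of points of the upper half-strip WITH multiplicity; its counting function is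
`count z T = #{n : im (z n) ≤ T}` (the abstract `N(T)`).  `comb` = the critical comb `½ + (n+1) i` (RH-shape, FE-symmetric);
`merged k` = the comb with its two points at heights `k+1`, `k+2` MERGED into the off-line FE-pair `½ ± ¼ + (k + 3/2) i`: FE-symmetric,
RH-shape up to height `k+1` (FIN-shape), NOT RH-shape above it, and with THE SAME COUNTING FUNCTION as the comb at every `T` outside the
single window `[k+1, k+2)` (`count_merged_eq`).  Hence `no_windowBlind_splitting` / `no_germ_splitting`: no property `P` of the counting
function that is invariant under a modification on one bounded window (in particular no GERM property: limits, `liminf`s, «for all large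
`T`», `o(N(T))`-densities) can serve as the tail `B` of a splitting `FIN ∧ B ⟹ RH` — at ANY certified height.  Dictionary to the card:
`count` ↔ `zetaZeroCount`, `OnLineUpTo` ↔ `RiemannHypothesisUpTo`, `OnLineAbove` ↔ `RHAbove`.  Blindness can only be typed on abstract
models (for `ζ` itself every statement «implies RH» if RH is true).

HONEST LABEL: «SPLITTING SEARCH over kernel-typed RH-EQUIVALENCES; a splitting A ∧ B ⟹ RH is CONDITIONAL bookkeeping unless A and B are
both proved; nothing here bears on the truth of RH.»  LABELS (referee g3): N53 = NOT A SPLITTING — RH-FREE KERNEL NO-GO at the interface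
level (ζ-specific arguments beyond the statistic are not excluded); class (zd, neg) UNCHANGED.
-/

set_option linter.dupNamespace false

noncomputable section

open Complex ComplexConjugate Filter Set

namespace Summit.RiemannHypothesis.RiemannHypothesis.Theorems.Splittings.ZdCountWindowBlindness

/-! ## §1 Configurations, shapes, counting functions -/

/-- A zero configuration: points listed with multiplicity. -/
abbrev Config : Type := ℕ → ℂ

/-- RH-shape. -/
def OnLine (z : Config) : Prop := ∀ n, (z n).re = 1 / 2

/-- RH-shape above height `H` (the tail). -/
def OnLineAbove (z : Config) (H : ℝ) : Prop := ∀ n, H < (z n).im → (z n).re = 1 / 2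

/-- FIN-shape: RH-shape up to height `H`. -/
def OnLineUpTo (z : Config) (H : ℝ) : Prop := ∀ n, (z n).im ≤ H → (z n).re = 1 / 2

/-- Functional-equation symmetry `ρ ↦ 1 - conj ρ` of the multiset. -/
def FESymm (z : Config) : Prop := ∀ n, ∃ m, z m = 1 - conj (z n)

/-- The index level set `{n : im z_n ≤ T}`. -/
def levelSet (z : Config) (T : ℝ) : Set ℕ := {n | (z n).im ≤ T}

/-- The counting function `N_z(T)` (finite level sets for all models below). -/
def count (z : Config) (T : ℝ) : ℕ := (levelSet z T).ncard

/-- All ordinate fibres above `H` have size `1` (unit jumps of `N`; distinct ordinates). -/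
def OrdInjectiveAbove (z : Config) (H : ℝ) : Prop :=
  ∀ n m, H < (z n).im → (z n).im = (z m).im → n = m

/-- All ordinate fibres above `H` have size `≤ 2` (jumps of `N` at most `2`). -/
def FibreLeTwoAbove (z : Config) (H : ℝ) : Prop :=
  ∀ n m l, H < (z n).im → (z n).im = (z m).im → (z n).im = (z l).im → n = m ∨ n = l ∨ m = l

/-- Every ordinate above `H` carries a critical point (the SIGNS half of a verification). -/
def CriticalAtEveryOrdinateAbove (z : Config) (H : ℝ) : Prop :=
  ∀ n, H < (z n).im → ∃ m, (z m).im = (z n).im ∧ (z m).re = 1 / 2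

/-- A property of counting functions invariant under modification on the window `[a, b)`. -/
def WindowBlind (a b : ℝ) (P : (ℝ → ℕ) → Prop) : Prop :=
  ∀ N N' : ℝ → ℕ, (∀ T, T ∉ Set.Ico a b → N T = N' T) → (P N ↔ P N')

/-- A germ property: depends only on the counting function for all large `T`. -/
def GermProperty (P : (ℝ → ℕ) → Prop) : Prop :=
  ∀ N N' : ℝ → ℕ, N =ᶠ[atTop] N' → (P N ↔ P N')

/-- RH-shape implies RH-shape above every height. -/
theorem OnLine.above {z : Config} (h : OnLine z) (H : ℝ) : OnLineAbove z H :=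
  fun n _ ↦ h n

/-- A germ property is blind to every bounded window. -/
theorem GermProperty.windowBlind {P : (ℝ → ℕ) → Prop} (hP : GermProperty P) (a b : ℝ) :
    WindowBlind a b P := by
  intro N N' h
  refine hP N N' ?_
  filter_upwards [eventually_ge_atTop b] with T hT
  exact h T (fun hm ↦ absurd hm.2 (not_lt.mpr hT))

/-! ## §2 The models -/

/-- `1 - conj (a + b i) = (1 - a) + b i`. -/
theorem one_sub_conj_mk (a b : ℝ) : (1 : ℂ) - conj (⟨a, b⟩ : ℂ) = ⟨1 - a, b⟩ := by
  apply Complex.ext <;> simp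

/-- The critical comb `½ + (n+1) i`. -/
def comb : Config := fun n ↦ ⟨1 / 2, n + 1⟩

/-- The comb with the points at heights `k+1`, `k+2` merged into the off-line FE-pair
`¾ + (k+3/2) i`, `¼ + (k+3/2) i`. -/
def merged (k : ℕ) : Config := fun n ↦
  if n = k then ⟨3 / 4, k + 3 / 2⟩ else if n = k + 1 then ⟨1 / 4, k + 3 / 2⟩ else ⟨1 / 2, n + 1⟩

/-- The comb with the points at heights `k+1`, `k+2`, `k+3` replaced by a critical point AND an
off-line FE-pair, all at height `k + 3/2` (the coincidence configuration). -/
def triple (k : ℕ) : Config := fun n ↦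
  if n = k then ⟨1 / 2, k + 3 / 2⟩ else if n = k + 1 then ⟨3 / 4, k + 3 / 2⟩
  else if n = k + 2 then ⟨1 / 4, k + 3 / 2⟩ else ⟨1 / 2, n + 1⟩

/-- Real parts of the comb: `1/2`. -/
@[simp] theorem comb_re (n : ℕ) : (comb n).re = 1 / 2 := rfl
/-- Ordinates of the comb: `n + 1`. -/
@[simp] theorem comb_im (n : ℕ) : (comb n).im = n + 1 := rfl

/-- Ordinates of `merged k`: `k + 3/2` at the two merged indices, `n + 1` elsewhere. -/
theorem merged_im (k n : ℕ) :
    (merged k n).im = if n = k ∨ n = k + 1 then (k : ℝ) + 3 / 2 else n + 1 := by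
  unfold merged
  by_cases h1 : n = k
  · simp [h1]
  · by_cases h2 : n = k + 1
    · simp [h2]
    · simp [h1, h2]

/-- Real parts of `merged k`: `1/2 ± 1/4` at the two merged indices, `1/2` elsewhere. -/
theorem merged_re (k n : ℕ) :
    (merged k n).re = if n = k then (3 : ℝ) / 4 else if n = k + 1 then 1 / 4 else 1 / 2 := by
  unfold merged
  by_cases h1 : n = k
  · simp [h1]
  · by_cases h2 : n = k + 1
    · simp [h2]
    · simp [h1, h2]

/-- Ordinates of `triple k`: `k + 3/2` at the three coincidence indices, `n + 1` elsewhere. -/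
theorem triple_im (k n : ℕ) :
    (triple k n).im = if n = k ∨ n = k + 1 ∨ n = k + 2 then (k : ℝ) + 3 / 2 else n + 1 := by
  unfold triple
  by_cases h1 : n = k
  · simp [h1]
  · by_cases h2 : n = k + 1
    · simp [h2]
    · by_cases h3 : n = k + 2
      · simp [h3]
      · simp [h1, h2, h3]

/-- Real parts of `triple k`: `1/4, 1/2, 3/4` at the three coincidence indices, `1/2` elsewhere. -/
theorem triple_re (k n : ℕ) :
    (triple k n).re = if n = k + 1 then (3 : ℝ) / 4 else if n = k + 2 then 1 / 4 else 1 / 2 := by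
  unfold triple
  by_cases h1 : n = k
  · simp [h1]
  · by_cases h2 : n = k + 1
    · simp [h2]
    · by_cases h3 : n = k + 2
      · simp [h3]
      · simp [h1, h2, h3]

/-- A half-integer height is never a comb height. -/
theorem half_ne_succ (k m : ℕ) : (k : ℝ) + 3 / 2 ≠ (m : ℝ) + 1 := by
  intro h
  have h2 : ((2 * k + 1 : ℕ) : ℝ) = ((2 * m : ℕ) : ℝ) := by push_cast; linarith
  have h3 : 2 * k + 1 = 2 * m := by exact_mod_cast h2
  omega

/-! ### Shapes of the comb -/

/-- The comb is RH-shaped. -/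
theorem onLine_comb : OnLine comb := fun _ ↦ rfl

/-- The comb is FE-symmetric. -/
theorem feSymm_comb : FESymm comb := by
  intro n
  refine ⟨n, ?_⟩
  show (⟨1 / 2, n + 1⟩ : ℂ) = 1 - conj (⟨1 / 2, n + 1⟩ : ℂ)
  rw [one_sub_conj_mk]
  norm_num

/-! ### Shapes of the merged configuration -/

/-- `merged k` is FE-symmetric (the off-line pair is swapped by `s ↦ 1 − s̄`). -/
theorem feSymm_merged (k : ℕ) : FESymm (merged k) := by
  intro n
  by_cases h1 : n = k
  · refine ⟨k + 1, ?_⟩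
    subst h1
    simp only [merged, if_true, Nat.succ_ne_self, if_false, one_sub_conj_mk]
    norm_num
  · by_cases h2 : n = k + 1
    · refine ⟨k, ?_⟩
      subst h2
      simp only [merged, if_true, Nat.succ_ne_self, if_false, one_sub_conj_mk]
      norm_num
    · refine ⟨n, ?_⟩
      simp only [merged, h1, h2, if_false, one_sub_conj_mk]
      norm_num

/-- `merged k` is RH-shaped up to height `k + 1` (FIN-shape). -/
theorem onLineUpTo_merged (k : ℕ) : OnLineUpTo (merged k) (k + 1) := by
  intro n hn
  rw [merged_im] at hn
  rw [merged_re]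
  by_cases h1 : n = k
  · simp [h1] at hn; linarith
  · by_cases h2 : n = k + 1
    · simp [h2] at hn; linarith
    · simp [h1, h2]

/-- `merged k` is NOT RH-shaped above height `k + 1`. -/
theorem not_onLineAbove_merged (k : ℕ) : ¬ OnLineAbove (merged k) (k + 1) := by
  intro h
  have h1 := h k (by rw [merged_im]; simp; linarith)
  rw [merged_re] at h1
  simp at h1
  norm_num at h1

/-- `merged k` is not RH-shaped. -/
theorem not_onLine_merged (k : ℕ) : ¬ OnLine (merged k) :=
  fun h ↦ not_onLineAbove_merged k (h.above _)

/-- Equal ordinates in the merged configuration: equal indices, or the merged pair. -/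
theorem merged_im_eq_iff (k n m : ℕ) (h : (merged k n).im = (merged k m).im) :
    n = m ∨ (n = k ∧ m = k + 1) ∨ (n = k + 1 ∧ m = k) := by
  rw [merged_im, merged_im] at h
  by_cases hn : n = k ∨ n = k + 1
  · by_cases hm : m = k ∨ m = k + 1
    · omega
    · rw [if_pos hn, if_neg hm] at h
      exact absurd h (half_ne_succ k m)
  · by_cases hm : m = k ∨ m = k + 1
    · rw [if_neg hn, if_pos hm] at h
      exact absurd h.symm (half_ne_succ k n)
    · rw [if_neg hn, if_neg hm] at h
      left
      exact_mod_cast (add_right_cancel h : (n : ℝ) = m)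

/-- All ordinate fibres of the merged configuration have size `≤ 2` (at every height). -/
theorem fibreLeTwo_merged (k : ℕ) (H : ℝ) : FibreLeTwoAbove (merged k) H := by
  intro n m l _ hnm hnl
  rcases merged_im_eq_iff k n m hnm with h | h | h
  · exact Or.inl h
  · rcases merged_im_eq_iff k n l hnl with h' | h' | h' <;> omega
  · rcases merged_im_eq_iff k n l hnl with h' | h' | h' <;> omega

/-! ### The counting function of the merged configuration equals the comb's off ONE window -/

/-- Off the window `[k+1, k+2)` the level sets of `merged k` and of the comb coincide. -/
theorem levelSet_merged_eq (k : ℕ) {T : ℝ} (hT : T ∉ Set.Ico ((k : ℝ) + 1) (k + 2)) :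
    levelSet (merged k) T = levelSet comb T := by
  have hT' : T < (k : ℝ) + 1 ∨ (k : ℝ) + 2 ≤ T := by
    rcases lt_or_ge T ((k : ℝ) + 1) with h | h
    · exact Or.inl h
    · rcases le_or_gt ((k : ℝ) + 2) T with h' | h'
      · exact Or.inr h'
      · exact absurd ⟨h, h'⟩ hT
  ext n
  simp only [levelSet, Set.mem_setOf_eq, comb_im, merged_im]
  by_cases hn : n = k ∨ n = k + 1
  · rw [if_pos hn]
    rcases hn with rfl | rfl
    · rcases hT' with h | h <;> constructor <;> intro <;> linarith
    · push_cast
      rcases hT' with h | h <;> constructor <;> intro <;> linarith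
  · rw [if_neg hn]

/-- **Exact invariance off one window.** -/
theorem count_merged_eq (k : ℕ) {T : ℝ} (hT : T ∉ Set.Ico ((k : ℝ) + 1) (k + 2)) :
    count (merged k) T = count comb T := by
  unfold count
  rw [levelSet_merged_eq k hT]

/-- In particular the two counting functions have the same germ at `+∞` … -/
theorem count_merged_eventuallyEq (k : ℕ) : count (merged k) =ᶠ[atTop] count comb := by
  filter_upwards [eventually_ge_atTop ((k : ℝ) + 2)] with T hT
  exact count_merged_eq k (fun hm ↦ absurd hm.2 (not_lt.mpr hT))

/-- … and agree at every height below the window (identical finite-height data). -/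
theorem count_merged_eq_below (k : ℕ) {T : ℝ} (hT : T < (k : ℝ) + 1) :
    count (merged k) T = count comb T :=
  count_merged_eq k (fun hm ↦ absurd hm.1 (not_le.mpr hT))

/-! ## §3 No window-blind (a fortiori no germ) property of the counting function splits RH

For every certified height `k + 1` and every property `P` of counting functions that the comb
enjoys and that is blind to the window `[k+1, k+2)`: the implication
`FE-symmetry ∧ FIN-shape(k+1) ∧ P(N_z) ⟹ RH-shape above k+1` FAILS (witness `merged k`). -/

/-- **Main theorem (tail form).** -/
theorem no_windowBlind_splitting (k : ℕ) {P : (ℝ → ℕ) → Prop}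
    (hP : WindowBlind ((k : ℝ) + 1) (k + 2) P) (h0 : P (count comb)) :
    ¬ ∀ z : Config, FESymm z → OnLineUpTo z (k + 1) → P (count z) → OnLineAbove z (k + 1) := by
  intro h
  refine not_onLineAbove_merged k (h _ (feSymm_merged k) (onLineUpTo_merged k) ?_)
  exact (hP (count (merged k)) (count comb) (fun T hT ↦ count_merged_eq k hT)).2 h0

/-- **Main theorem (germ form).** No asymptotic statistic of `N(T)` is a splitting partner. -/
theorem no_germ_splitting (k : ℕ) {P : (ℝ → ℕ) → Prop} (hP : GermProperty P)
    (h0 : P (count comb)) :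
    ¬ ∀ z : Config, FESymm z → OnLineUpTo z (k + 1) → P (count z) → OnLineAbove z (k + 1) :=
  no_windowBlind_splitting k (hP.windowBlind _ _) h0

/-- The same with the full RH-shape as conclusion. -/
theorem no_germ_splitting' (k : ℕ) {P : (ℝ → ℕ) → Prop} (hP : GermProperty P)
    (h0 : P (count comb)) :
    ¬ ∀ z : Config, FESymm z → OnLineUpTo z (k + 1) → P (count z) → OnLine z :=
  fun h ↦ no_germ_splitting k hP h0 (fun z h1 h2 h3 ↦ (h z h1 h2 h3).above _)

/-! ### Germ properties: the shapes of the named statistics -/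

/-- "Eventually `Q(T, N(T))`" is a germ property (tails of local statements, `O`/`o`-bounds with
an unspecified onset, almost-all-`T` statements phrased with `∀ᶠ`). -/
theorem germProperty_eventually (Q : ℝ → ℕ → Prop) :
    GermProperty (fun N ↦ ∀ᶠ T in atTop, Q T (N T)) := by
  intro N N' h
  constructor
  · intro hQ
    filter_upwards [hQ, h] with T h1 h2
    rwa [← h2]
  · intro hQ
    filter_upwards [hQ, h] with T h1 h2
    rwa [h2]

/-- "`F(T, N(T)) → ℓ`" is a germ property (limits, densities, proportions). -/
theorem germProperty_tendsto {α : Type*} (F : ℝ → ℕ → α) (l : Filter α) :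
    GermProperty (fun N ↦ Tendsto (fun T ↦ F T (N T)) atTop l) := by
  intro N N' h
  have hc : (fun T ↦ F T (N T)) =ᶠ[atTop] (fun T ↦ F T (N' T)) := by
    filter_upwards [h] with T hT
    rw [hT]
  exact ⟨fun ht ↦ ht.congr' hc, fun ht ↦ ht.congr' hc.symm⟩

/-- "`liminf F(T, N(T)) = c`" is a germ property. -/
theorem germProperty_liminf (F : ℝ → ℕ → ℝ) (c : ℝ) :
    GermProperty (fun N ↦ Filter.liminf (fun T ↦ F T (N T)) atTop = c) := by
  intro N N' h
  have hc : (fun T ↦ F T (N T)) =ᶠ[atTop] (fun T ↦ F T (N' T)) := by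
    filter_upwards [h] with T hT
    rw [hT]
  show Filter.liminf (fun T ↦ F T (N T)) atTop = c ↔ Filter.liminf (fun T ↦ F T (N' T)) atTop = c
  rw [Filter.liminf_congr hc]

/-- A germ property may look at the WHOLE germ (e.g. differences `N(T+h) − N(T)`, pair counts, gap
sequences above an unspecified height): "eventually `Q(T, N)` where `Q(T, ·)` reads `N` only on
`[T, ∞)`". -/
theorem germProperty_eventually_tail (Q : ℝ → (ℝ → ℕ) → Prop)
    (hQ : ∀ T N N', (∀ t, T ≤ t → N t = N' t) → (Q T N ↔ Q T N')) :
    GermProperty (fun N ↦ ∀ᶠ T in atTop, Q T N) := by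
  intro N N' h
  obtain ⟨T₀, hT₀⟩ := eventually_atTop.1 h
  constructor
  · intro hq
    filter_upwards [hq, eventually_ge_atTop T₀] with T h1 h2
    exact (hQ T N N' (fun t ht ↦ hT₀ t (le_trans h2 ht))).1 h1
  · intro hq
    filter_upwards [hq, eventually_ge_atTop T₀] with T h1 h2
    exact (hQ T N N' (fun t ht ↦ hT₀ t (le_trans h2 ht))).2 h1

end Summit.RiemannHypothesis.RiemannHypothesis.Theorems.Splittings.ZdCountWindowBlindness

end
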